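import Mathlib.Analysis.InnerProductSpace.Adjoint
import Mathlib.Analysis.InnerProductSpace.Projection.FiniteDimensional
import Mathlib.LinearAlgebra.Determinant
import HarnessLib

/-!
# The finite-dimensional Faddeev–Popov determinant identity `det(H + D D*) = det(H|_{(im D)^⊥}) · det(D* D)`

`ym-ust-20520-w4` g15 — a definition-free linear-algebra letter for the DECAY row of LINE g18-1
`Cruxes/FluctuationComparisonRegPrIntL/Lines/semiclassical_s2beta.lean` (crux `stmt-QuantumFields-20520`, stub `FourPtDecay`; memo
`LOCATE-DECAY-w4g15.md` (CLF-a)).  In the semiclassical (one-loop) constant of a group-invariant Laplace integral the transverse Hessian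
`H^⊥` of the action at a minimiser and the orbit-volume (Faddeev–Popov) factor `det(D* D)^{1/2}` of the orbit map's differential `D`
combine into determinants of two LOCAL operators: the gauge-fixed fluctuation operator `H + D D*` and the Faddeev–Popov operator `D* D`
([Balaban1987RG1] (0.19)–(0.26); [Dimock2013BalabanII] (282)–(284)).  The identity behind this is elementary: if a linear map `f` of a
finite-dimensional space preserves two complementary subspaces, its determinant is the product of the determinants of the two restrictions
(§1, over any field), and for `D` injective, `H D = 0`, `H` mapping `(im D)^⊥` into itself, the map `H + D D*` preserves `im D` (acting there as
`D D*`, conjugate to `D* D` by `D`) and `(im D)^⊥` (acting there as `H`) (§2).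

* §1 `det_eq_det_restrict_mul_det_restrict` — `det f = det (f|_p) · det (f|_q)` for `IsCompl p q`, `f p ⊆ p`, `f q ⊆ q`.
* §2 `adjoint_apply_eq_zero_of_mem_orthogonal_range` (`D* v = 0` for `v ⊥ im D`), `mem_orthogonal_range_of_isSymmetric` (a symmetric `H` with
  `H D = 0` maps `(im D)^⊥` into itself), ★ `det_add_comp_adjoint_eq` — `det (H + D ∘ D*) = det (H|_{(im D)^⊥}) · det (D* ∘ D)`, and the symmetric
  edition ★ `det_add_comp_adjoint_eq_of_isSymmetric`.

HONEST: pure linear algebra; proves nothing of LINE g18-1's stubs (FOUR-POINT-DECAY, EXW, GAP♯, H4ᶜ, LFR♯ᶜ), of S2β or of the crux 20520;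
rung R3 (YM₃ on T³) is NOT d = 4, NOT infinite volume, NOT a mass gap, NOT Clay.  Def-free; default heartbeats.
-/

namespace Literature.Analysis.Matrix

open scoped InnerProductSpace

/-! ## §1 Determinant of a map preserving a complementary pair of subspaces -/

section Split

variable {K : Type*} [Field K] {E : Type*} [AddCommGroup E] [Module K E] [FiniteDimensional K E]

/-- **`det f = det (f|_p) · det (f|_q)`** when `f` preserves both members of a complementary pair `p ⊕ q = E` (block-diagonal determinant,
basis-free).  The same folklore statement exists in the tree as `Literature.LinearAlgebra.det_eq_det_restrict_mul_det_restrict_of_isCompl`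
(`Set.MapsTo` form, in `Literature/AlgebraicGeometry/Motives/FrobeniusRealWeilNumberPart.lean`) and over `ℂ` in
`Literature/AlgebraicGeometry/HodgeTheory/DetRestrictBlocks.lean`; it is restated here over `∀ x ∈ p, f x ∈ p` to keep this file's import cone inside
Mathlib (px10 g8 read 2026-08-29). [cite: Balaban1987RG1, (0.21) p.256] -/
theorem det_eq_det_restrict_mul_det_restrict {p q : Submodule K E} (hpq : IsCompl p q) (f : E →ₗ[K] E)
    (hp : ∀ x ∈ p, f x ∈ p) (hq : ∀ x ∈ q, f x ∈ q) :
    LinearMap.det f = LinearMap.det (f.restrict hp) * LinearMap.det (f.restrict hq) := by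
  set e := Submodule.prodEquivOfIsCompl p q hpq with he
  have hconj : f = (e : (p × q) →ₗ[K] E) ∘ₗ (LinearMap.prodMap (f.restrict hp) (f.restrict hq)) ∘ₗ (e.symm : E →ₗ[K] (p × q)) := by
    apply LinearMap.ext
    intro x
    obtain ⟨y, rfl⟩ := e.surjective x
    rw [LinearMap.comp_apply, LinearMap.comp_apply, LinearEquiv.coe_coe, LinearEquiv.coe_coe, LinearEquiv.symm_apply_apply,
      LinearMap.prodMap_apply, he, Submodule.coe_prodEquivOfIsCompl', Submodule.coe_prodEquivOfIsCompl', map_add,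
      LinearMap.coe_restrict_apply, LinearMap.coe_restrict_apply]
  have hdet := congrArg LinearMap.det hconj
  rw [LinearMap.det_conj, LinearMap.det_prodMap] at hdet
  exact hdet

end Split

/-! ## §2 The Faddeev–Popov splitting of `H + D D*` -/

section FaddeevPopov

variable {V W : Type*} [NormedAddCommGroup V] [InnerProductSpace ℝ V] [FiniteDimensional ℝ V]
  [NormedAddCommGroup W] [InnerProductSpace ℝ W] [FiniteDimensional ℝ W]

/-- `D* v = 0` for `v` orthogonal to the range of `D`. [cite: Balaban1987RG1, (0.21) p.256] -/
theorem adjoint_apply_eq_zero_of_mem_orthogonal_range (D : W →ₗ[ℝ] V) {v : V} (hv : v ∈ (LinearMap.range D)ᗮ) :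
    LinearMap.adjoint D v = 0 := by
  rw [← @inner_self_eq_zero ℝ, LinearMap.adjoint_inner_left]
  exact (Submodule.mem_orthogonal' _ _).1 hv _ (LinearMap.mem_range_self D _)

omit [FiniteDimensional ℝ V] [FiniteDimensional ℝ W] in
/-- A symmetric `H` killing the range of `D` maps the orthogonal complement of that range into itself.
[cite: Balaban1987RG1, (0.21) p.256] -/
theorem mem_orthogonal_range_of_isSymmetric (D : W →ₗ[ℝ] V) {H : V →ₗ[ℝ] V} (hH : H.IsSymmetric)
    (hHD : ∀ w, H (D w) = 0) : ∀ v ∈ (LinearMap.range D)ᗮ, H v ∈ (LinearMap.range D)ᗮ := by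
  intro v _
  rw [Submodule.mem_orthogonal]
  rintro u ⟨w, rfl⟩
  rw [← hH, hHD, inner_zero_left]

/-- ★ **FADDEEV–POPOV DETERMINANT IDENTITY**: for `D : W → V` injective and `H : V → V` with `H ∘ D = 0` mapping `(im D)^⊥` into itself,
`det (H + D ∘ D*) = det (H|_{(im D)^⊥}) · det (D* ∘ D)`.  (`H + D D*` preserves `im D`, acting there as `D D*`, which `D` conjugates to `D* D`;
and preserves `(im D)^⊥`, acting there as `H`.) [cite: Balaban1987RG1, (0.21)-(0.26) p.256] -/
theorem det_add_comp_adjoint_eq (D : W →ₗ[ℝ] V) (hD : Function.Injective D) (H : V →ₗ[ℝ] V)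
    (hHD : ∀ w, H (D w) = 0) (hHQ : ∀ v ∈ (LinearMap.range D)ᗮ, H v ∈ (LinearMap.range D)ᗮ) :
    LinearMap.det (H + D ∘ₗ LinearMap.adjoint D) =
      LinearMap.det (H.restrict hHQ) * LinearMap.det (LinearMap.adjoint D ∘ₗ D) := by
  set f : V →ₗ[ℝ] V := H + D ∘ₗ LinearMap.adjoint D with hf
  -- `f` preserves the range of `D` …
  have hP : ∀ x ∈ LinearMap.range D, f x ∈ LinearMap.range D := by
    rintro x ⟨w, rfl⟩
    refine ⟨LinearMap.adjoint D (D w), ?_⟩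
    simp only [hf, LinearMap.add_apply, LinearMap.coe_comp, Function.comp_apply, hHD, zero_add]
  -- … and its orthogonal complement, where it IS `H`
  have hfQ : ∀ x ∈ (LinearMap.range D)ᗮ, f x = H x := fun x hx => by
    simp only [hf, LinearMap.add_apply, LinearMap.coe_comp, Function.comp_apply,
      adjoint_apply_eq_zero_of_mem_orthogonal_range D hx, map_zero, add_zero]
  have hQ : ∀ x ∈ (LinearMap.range D)ᗮ, f x ∈ (LinearMap.range D)ᗮ := fun x hx => (hfQ x hx).symm ▸ hHQ x hx
  have hsplit := det_eq_det_restrict_mul_det_restrict (Submodule.isCompl_orthogonal (K := LinearMap.range D)) f hP hQ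
  -- the restriction to `(im D)^⊥` is the restriction of `H`
  have hresQ : f.restrict hQ = H.restrict hHQ := by
    apply LinearMap.ext
    intro x
    apply Subtype.ext
    simp only [LinearMap.coe_restrict_apply, hfQ x x.2]
  -- the restriction to `im D` is conjugate to `D* D` through `D : W ≃ im D`
  set eD := LinearEquiv.ofInjective D hD with heD
  have hresP : f.restrict hP = (eD : W →ₗ[ℝ] LinearMap.range D) ∘ₗ (LinearMap.adjoint D ∘ₗ D) ∘ₗ (eD.symm : LinearMap.range D →ₗ[ℝ] W) := by
    apply LinearMap.ext
    intro x
    obtain ⟨w, rfl⟩ := eD.surjective x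
    apply Subtype.ext
    simp only [LinearMap.coe_restrict_apply, LinearMap.coe_comp, LinearEquiv.coe_coe, Function.comp_apply,
      LinearEquiv.symm_apply_apply, heD, LinearEquiv.ofInjective_apply, hf, LinearMap.add_apply, hHD, zero_add]
  rw [hsplit, hresQ, hresP, LinearMap.det_conj, mul_comm]

/-- ★ **FADDEEV–POPOV DETERMINANT IDENTITY, SYMMETRIC EDITION**: for `D` injective and `H` symmetric with `H ∘ D = 0` (the Hessian of a
`D`-invariant function at a critical orbit kills the orbit tangent `im D`), `det (H + D ∘ D*) = det (H|_{(im D)^⊥}) · det (D* ∘ D)`, the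
restriction being to the orthogonal complement of the orbit tangent (the transverse Hessian). [cite: Balaban1987RG1, (0.21)-(0.26) p.256] -/
theorem det_add_comp_adjoint_eq_of_isSymmetric (D : W →ₗ[ℝ] V) (hD : Function.Injective D) {H : V →ₗ[ℝ] V} (hH : H.IsSymmetric)
    (hHD : ∀ w, H (D w) = 0) :
    LinearMap.det (H + D ∘ₗ LinearMap.adjoint D) =
      LinearMap.det (H.restrict (mem_orthogonal_range_of_isSymmetric D hH hHD)) * LinearMap.det (LinearMap.adjoint D ∘ₗ D) :=
  det_add_comp_adjoint_eq D hD H hHD _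

end FaddeevPopov

end Literature.Analysis.Matrix
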